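import Summits.BirchSwinnertonDyer.BirchSwinnertonDyer.Theorems.GoldfeldAllTwistsTwoConverseTwinGenusDescentRankZero
import Summits.BirchSwinnertonDyer.BirchSwinnertonDyer.Theorems.GoldfeldAllTwistsTwoConverseTwinAdditiveSign
import Summits.BirchSwinnertonDyer.BirchSwinnertonDyer.Theorems.GoldfeldAllTwistsTwoConverseTwinHalfTraceSevenModEightRankOne
import Literature.NumberTheory.EllipticCurves.BSDRootNumberSmallConductorProofs
import HarnessLib

set_option linter.dupNamespace false -- `…BirchSwinnertonDyer.BirchSwinnertonDyer…` is the cell's namespace (D-0017)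
set_option autoImplicit false

/-!
# LINE C2 — THE PARTNER AT `ℓ = 3`: `49a1^{(−3)}` (`N = 441`) has rank ONE, `Ш[2] = 0`, `r_an = 1`, `Ш` finite of odd order
# (complete `2`-isogeny descent `S(−63, 1008) = {1, 7}`, `S(126, −63) = {1, −3, −7, 21}`; family F3 at `q = 3`)

Cell `bsd-goldfeld`, seat `bsd-goldfeld-s1p-c3x` (prover, gen 6); planner g38 ORDER (clxiii) «LINE C2 — PARTNER ℓ = 3», ONE file,
`--supports stmt-BirchSwinnertonDyer-19350` (route decl `Theses.GoldfeldAllTwistsTwoConverse.BSDTwoCMSplitRankOne`) as a HELPER.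
Theses-free; theorems only; no definition, no new fact, no new cite key. HONEST FRAMING: theorems about ONE explicit curve — the
GOOD-at-`2` twist `49a1^{(−3)}` (conductor `441`, inside Cremona's verified range) — plus its bsd.S31 hook; BSD is not proved by any of
this; items 19350 / 19140 / 20044 / 19349 are untouched.

WHY. On family F3 (`49a1^{(−2ℓ)}`, `d_K = −8ℓ`, `ℓ ≡ 3 (mod 4)` prime, `(ℓ/7) = −1`) the half-trace device of this lane (THEOREMS A″/A‴,
B″/B‴) consumes the RANK-ONE PARTNER `49a1^{(−ℓ)}` through Coates–Li–Tian–Zhai 2015 Thm. 1.4 BY NAME (`thm14_rankOne_twist`, typed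
with `3 < l₀`; seat c3's `rankOne_negPrimeTwist_of_thm14'`), and only as «`rank V₁(ℚ) = 1`» ((RO″), `…SevenModEightRankOne`) and
«`r_an(49a1^{(−ℓ)}) = 1`» ((HR″)). At `ℓ = 3` that fact is silent, but the partner is the conductor-`441` curve: this file supplies the
SAME package for every globally minimal model from a kernel `2`-isogeny descent, Cremona's `r_an = rank` for `N < 130000` (`hCr`), the
sign of a negative twist (seat c301's `analyticRank_eq_one_iff_le_one_of_smul_eq_quadraticTwist_cm7_of_neg`, `hnf h12`) and bsd.S31
(`hS31`, `N < 5000`) — the missing partner input of the formula axis at `q = 3` (`BSD(W, 2)` for `W ≅ 49a1^{(−6)}`; not ordered).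

## Contents
§1 a residue obstruction at ANY prime (`not_isSoluble_padic_of_zmodPow`, the odd-`p` twin of seat c301's `not_isSoluble_two_of_zmodPow`)
and the residue keys (mod `4`/`16` at `2`, mod `9` at `3`; `decide`). §2 the two Selmer sets of the two-torsion model
`E₃ = [0, −63, 0, 1008, 0] = (1/2, −6, 0, 0) • cm7^{(−3)}`: `S(−63, 1008) ⊆ {1, 7}` (negative classes die over `ℝ`, `2, 6, 14, 42`
die `2`-adically, `3, 21` die `3`-adically), `S' = S(126, −63) ⊆ {1, −3, −7, 21}` (`−1, 3, 7, −21` die `2`-adically). §3 the count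
`#S·#S' ≤ 8` ⟹ **`rank ≤ 1`, and `rank = 1 ⟹ Ш[2] = 0`, UNCONDITIONALLY, for every model of `49a1^{(−3)}`**. §4
**`rankOne_negPrimeTwist_three (hnf h12 hCr hS31)`**: `r_an = 1 ∧ rank = 1 ∧ Ш finite ∧ #Ш odd` for every globally minimal
`W' ≅ 49a1^{(−3)}` — the `ℓ₀ = 3` case EXCLUDED from CLTZ Thm. 1.4 as typed, in the exact output shape of `rankOne_negPrimeTwist_of_thm14'`
— and the union over ALL primes `ℓ ≡ 3 (mod 4)`, `(ℓ/7) = −1`. §5 the (RO″) interface `rank V₁(ℚ) = 1` from a partner package.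
NUMERICS (cheapest falsifier, run BEFORE the build; local script, seconds): the 16 + 8 candidate classes, their local solubility at
`∞, 2, 3, 7`, the minimal obstruction moduli; `(36, 36) ∈ E₃(ℚ)` with `3·(36, 36) = (324/25, −8532/125)`.
References: [SilvermanAEC2009] X.4.2(a), X.4.9, X.4.10; [Cremona2006] (curve 441); [CreutzMiller2012] Thm 1.1; [Miller2011LMS];
[CoatesLiTianZhai2015] Thm 1.4 (the excluded `l₀ = 3`); [MurtyMurty1997] Ch. 6 §1 (conductor / sign of the twist).
-/

noncomputable section

open scoped Classical

open WeierstrassCurve Literature.NumberTheory.EllipticCurves Literature.NumberTheory.EllipticCurves.ModularForms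
  Literature.NumberTheory.EllipticCurves.CoatesLiTianZhai2015
open Literature.NumberTheory.EllipticCurves.Zywina2025 (exists_padicInt_of_isSoluble)

namespace Summit.BirchSwinnertonDyer.BirchSwinnertonDyer.Theorems.GoldfeldGoodTwists

/-! ## §1 Residue obstructions -/

section Local

/-- **`p`-adic obstruction by residues, any prime `p`** (odd-`p` twin of seat c301's `not_isSoluble_two_of_zmodPow`): if neither
`ℤ_p`-chart of `w² = d u⁴ + a u²z² + d' z⁴` has a solution modulo `pᵏ` resp. `pᵏ'`, the quartic has no non-trivial `ℚ_p`-point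
(`exists_padicInt_of_isSoluble`). [cite: SilvermanAEC2009, Prop. X.4.9 and Example X.4.10] -/
theorem not_isSoluble_padic_of_zmodPow {p : ℕ} [Fact p.Prime] {a d d' : ℤ} (k k' : ℕ)
    (hA : ∀ T S : ZMod (p ^ k), S ^ 2 ≠ (d : ZMod (p ^ k)) + a * T ^ 2 + d' * T ^ 4)
    (hB : ∀ T S : ZMod (p ^ k'), S ^ 2 ≠ (d' : ZMod (p ^ k')) + a * T ^ 2 + d * T ^ 4) :
    ¬ ((twoIsogenyQuartic a d d').map (Int.castRingHom ℚ_[p])).IsSoluble := by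
  intro h
  obtain ⟨f, f', hff, t, s, hs⟩ := exists_padicInt_of_isSoluble h
  rcases hff with ⟨rfl, rfl⟩ | ⟨rfl, rfl⟩
  · have h2 := congrArg (PadicInt.toZModPow k : ℤ_[p] →+* ZMod (p ^ k)) hs
    simp only [map_pow, map_add, map_mul, map_intCast] at h2
    exact hA _ _ h2
  · have h2 := congrArg (PadicInt.toZModPow k' : ℤ_[p] →+* ZMod (p ^ k')) hs
    simp only [map_pow, map_add, map_mul, map_intCast] at h2
    exact hB _ _ h2

/-- Residues of `S(−63, 1008)` at `2`: the even classes `d = 2, 6, 14, 42` die in both `ℤ₂`-charts (mod `4` / mod `16`). [folklore] -/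
theorem zmod_keys_1008_even :
    ((∀ T S : ZMod (2 ^ 2), S ^ 2 ≠ ((2 : ℤ) : ZMod (2 ^ 2)) + ((-63 : ℤ) : ZMod (2 ^ 2)) * T ^ 2 + ((504 : ℤ) : ZMod (2 ^ 2)) * T ^ 4) ∧
      (∀ T S : ZMod (2 ^ 4), S ^ 2 ≠ ((504 : ℤ) : ZMod (2 ^ 4)) + ((-63 : ℤ) : ZMod (2 ^ 4)) * T ^ 2 + ((2 : ℤ) : ZMod (2 ^ 4)) * T ^ 4)) ∧
    ((∀ T S : ZMod (2 ^ 2), S ^ 2 ≠ ((6 : ℤ) : ZMod (2 ^ 2)) + ((-63 : ℤ) : ZMod (2 ^ 2)) * T ^ 2 + ((168 : ℤ) : ZMod (2 ^ 2)) * T ^ 4) ∧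
      (∀ T S : ZMod (2 ^ 4), S ^ 2 ≠ ((168 : ℤ) : ZMod (2 ^ 4)) + ((-63 : ℤ) : ZMod (2 ^ 4)) * T ^ 2 + ((6 : ℤ) : ZMod (2 ^ 4)) * T ^ 4)) ∧
    ((∀ T S : ZMod (2 ^ 2), S ^ 2 ≠ ((14 : ℤ) : ZMod (2 ^ 2)) + ((-63 : ℤ) : ZMod (2 ^ 2)) * T ^ 2 + ((72 : ℤ) : ZMod (2 ^ 2)) * T ^ 4) ∧
      (∀ T S : ZMod (2 ^ 4), S ^ 2 ≠ ((72 : ℤ) : ZMod (2 ^ 4)) + ((-63 : ℤ) : ZMod (2 ^ 4)) * T ^ 2 + ((14 : ℤ) : ZMod (2 ^ 4)) * T ^ 4)) ∧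
    ((∀ T S : ZMod (2 ^ 2), S ^ 2 ≠ ((42 : ℤ) : ZMod (2 ^ 2)) + ((-63 : ℤ) : ZMod (2 ^ 2)) * T ^ 2 + ((24 : ℤ) : ZMod (2 ^ 2)) * T ^ 4) ∧
      (∀ T S : ZMod (2 ^ 4), S ^ 2 ≠ ((24 : ℤ) : ZMod (2 ^ 4)) + ((-63 : ℤ) : ZMod (2 ^ 4)) * T ^ 2 + ((42 : ℤ) : ZMod (2 ^ 4)) * T ^ 4)) := by
  refine ⟨⟨?_, ?_⟩, ⟨?_, ?_⟩, ⟨?_, ?_⟩, ⟨?_, ?_⟩⟩ <;> decide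

/-- Residues of `S(−63, 1008)` at `3`: the classes `d = 3, 21` die in both `ℤ₃`-charts (mod `9`). [folklore] -/
theorem zmod_keys_1008_three :
    ((∀ T S : ZMod (3 ^ 2), S ^ 2 ≠ ((3 : ℤ) : ZMod (3 ^ 2)) + ((-63 : ℤ) : ZMod (3 ^ 2)) * T ^ 2 + ((336 : ℤ) : ZMod (3 ^ 2)) * T ^ 4) ∧
      (∀ T S : ZMod (3 ^ 2), S ^ 2 ≠ ((336 : ℤ) : ZMod (3 ^ 2)) + ((-63 : ℤ) : ZMod (3 ^ 2)) * T ^ 2 + ((3 : ℤ) : ZMod (3 ^ 2)) * T ^ 4)) ∧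
    ((∀ T S : ZMod (3 ^ 2), S ^ 2 ≠ ((21 : ℤ) : ZMod (3 ^ 2)) + ((-63 : ℤ) : ZMod (3 ^ 2)) * T ^ 2 + ((48 : ℤ) : ZMod (3 ^ 2)) * T ^ 4) ∧
      (∀ T S : ZMod (3 ^ 2), S ^ 2 ≠ ((48 : ℤ) : ZMod (3 ^ 2)) + ((-63 : ℤ) : ZMod (3 ^ 2)) * T ^ 2 + ((21 : ℤ) : ZMod (3 ^ 2)) * T ^ 4)) := by
  refine ⟨⟨?_, ?_⟩, ⟨?_, ?_⟩⟩ <;> decide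

/-- Residues of `S(126, −63)` at `2`: the classes `d = −1, 3, 7, −21` die in both `ℤ₂`-charts (mod `16`). [folklore] -/
theorem zmod_keys_neg63 :
    ((∀ T S : ZMod (2 ^ 4), S ^ 2 ≠ ((-1 : ℤ) : ZMod (2 ^ 4)) + ((126 : ℤ) : ZMod (2 ^ 4)) * T ^ 2 + ((63 : ℤ) : ZMod (2 ^ 4)) * T ^ 4) ∧
      (∀ T S : ZMod (2 ^ 4), S ^ 2 ≠ ((63 : ℤ) : ZMod (2 ^ 4)) + ((126 : ℤ) : ZMod (2 ^ 4)) * T ^ 2 + ((-1 : ℤ) : ZMod (2 ^ 4)) * T ^ 4)) ∧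
    ((∀ T S : ZMod (2 ^ 4), S ^ 2 ≠ ((3 : ℤ) : ZMod (2 ^ 4)) + ((126 : ℤ) : ZMod (2 ^ 4)) * T ^ 2 + ((-21 : ℤ) : ZMod (2 ^ 4)) * T ^ 4) ∧
      (∀ T S : ZMod (2 ^ 4), S ^ 2 ≠ ((-21 : ℤ) : ZMod (2 ^ 4)) + ((126 : ℤ) : ZMod (2 ^ 4)) * T ^ 2 + ((3 : ℤ) : ZMod (2 ^ 4)) * T ^ 4)) ∧
    ((∀ T S : ZMod (2 ^ 4), S ^ 2 ≠ ((7 : ℤ) : ZMod (2 ^ 4)) + ((126 : ℤ) : ZMod (2 ^ 4)) * T ^ 2 + ((-9 : ℤ) : ZMod (2 ^ 4)) * T ^ 4) ∧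
      (∀ T S : ZMod (2 ^ 4), S ^ 2 ≠ ((-9 : ℤ) : ZMod (2 ^ 4)) + ((126 : ℤ) : ZMod (2 ^ 4)) * T ^ 2 + ((7 : ℤ) : ZMod (2 ^ 4)) * T ^ 4)) ∧
    ((∀ T S : ZMod (2 ^ 4), S ^ 2 ≠ ((-21 : ℤ) : ZMod (2 ^ 4)) + ((126 : ℤ) : ZMod (2 ^ 4)) * T ^ 2 + ((3 : ℤ) : ZMod (2 ^ 4)) * T ^ 4) ∧
      (∀ T S : ZMod (2 ^ 4), S ^ 2 ≠ ((3 : ℤ) : ZMod (2 ^ 4)) + ((126 : ℤ) : ZMod (2 ^ 4)) * T ^ 2 + ((-21 : ℤ) : ZMod (2 ^ 4)) * T ^ 4)) := by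
  refine ⟨⟨?_, ?_⟩, ⟨?_, ?_⟩, ⟨?_, ?_⟩, ⟨?_, ?_⟩⟩ <;> decide

end Local

/-! ## §2 The two Selmer sets of `E₃ : y² = x³ − 63x² + 1008x` (`= (1/2, −6, 0, 0) • cm7^{(−3)}`) -/

section Selmer

/-- Squarefree divisors of `1008 = 2⁴·3²·7`: `|d| ∈ {1, 2, 3, 6, 7, 14, 21, 42}`. [folklore] -/
theorem natAbs_mem_of_squarefree_of_dvd_1008 {d : ℤ} (hsq : Squarefree d) (hd : d ∣ 1008) :
    d.natAbs ∈ ({1, 2, 3, 6, 7, 14, 21, 42} : Finset ℕ) := by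
  have h1 : d.natAbs ∣ 1008 := by exact_mod_cast Int.natAbs_dvd_natAbs.mpr hd
  have h2 : Squarefree d.natAbs := Int.squarefree_natAbs.mpr hsq
  have hmem : d.natAbs ∈ (Nat.divisors 1008).filter Squarefree :=
    Finset.mem_filter.mpr ⟨Nat.mem_divisors.mpr ⟨h1, by norm_num⟩, h2⟩
  have hset : (Nat.divisors 1008).filter Squarefree = {1, 2, 3, 6, 7, 14, 21, 42} := by decide +kernel
  rwa [hset] at hmem

/-- Squarefree divisors of `−63 = −3²·7`: `|d| ∈ {1, 3, 7, 21}`. [folklore] -/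
theorem natAbs_mem_of_squarefree_of_dvd_neg63 {d : ℤ} (hsq : Squarefree d) (hd : d ∣ -63) :
    d.natAbs ∈ ({1, 3, 7, 21} : Finset ℕ) := by
  have h1 : d.natAbs ∣ 63 := by have := Int.natAbs_dvd_natAbs.mpr hd; simpa using this
  have h2 : Squarefree d.natAbs := Int.squarefree_natAbs.mpr hsq
  have hmem : d.natAbs ∈ (Nat.divisors 63).filter Squarefree :=
    Finset.mem_filter.mpr ⟨Nat.mem_divisors.mpr ⟨h1, by norm_num⟩, h2⟩
  have hset : (Nat.divisors 63).filter Squarefree = {1, 3, 7, 21} := by decide +kernel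
  rwa [hset] at hmem

/-- **`S(−63, 1008) ⊆ {1, 7}`** (the descent-on-divisors-of-`b` Selmer set of `E₃`): negative classes die over `ℝ`
(`63² = 3969 < 4032 = 4·1008`), `2, 6, 14, 42` die `2`-adically, `3, 21` die `3`-adically; `1` and `7 ≡ 1008` are the images
of `O` and `T`. [cite: SilvermanAEC2009, Prop. X.4.9 and Example X.4.10] -/
theorem mem_twoIsogenySelmerGroup_1008 {d : ℤ} (h : d ∈ twoIsogenySelmerGroup (-63) 1008) : d = 1 ∨ d = 7 := by
  haveI : Fact (Nat.Prime 2) := ⟨Nat.prime_two⟩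
  haveI : Fact (Nat.Prime 3) := ⟨Nat.prime_three⟩
  obtain ⟨hsq, hdvd, hloc⟩ := (mem_twoIsogenySelmerGroup_iff (by norm_num : (1008 : ℤ) ≠ 0)).mp h
  have habs := natAbs_mem_of_squarefree_of_dvd_1008 hsq hdvd
  simp only [Finset.mem_insert, Finset.mem_singleton] at habs
  obtain ⟨⟨kA2, kB2⟩, ⟨kA6, kB6⟩, ⟨kA14, kB14⟩, ⟨kA42, kB42⟩⟩ := zmod_keys_1008_even
  obtain ⟨⟨kA3, kB3⟩, ⟨kA21, kB21⟩⟩ := zmod_keys_1008_three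
  rcases Int.natAbs_eq d with hpos | hneg
  · rcases habs with h1 | h2 | h3 | h6 | h7 | h14 | h21 | h42
    · left; omega
    · exfalso
      have hd : d = 2 := by omega
      subst hd
      have h' := hloc.2 2
      rw [show (1008 : ℤ) / 2 = 504 by norm_num] at h'
      exact not_isSoluble_padic_of_zmodPow 2 4 kA2 kB2 h'
    · exfalso
      have hd : d = 3 := by omega
      subst hd
      have h' := hloc.2 3
      rw [show (1008 : ℤ) / 3 = 336 by norm_num] at h'
      exact not_isSoluble_padic_of_zmodPow 2 2 kA3 kB3 h'
    · exfalso
      have hd : d = 6 := by omega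
      subst hd
      have h' := hloc.2 2
      rw [show (1008 : ℤ) / 6 = 168 by norm_num] at h'
      exact not_isSoluble_padic_of_zmodPow 2 4 kA6 kB6 h'
    · right; omega
    · exfalso
      have hd : d = 14 := by omega
      subst hd
      have h' := hloc.2 2
      rw [show (1008 : ℤ) / 14 = 72 by norm_num] at h'
      exact not_isSoluble_padic_of_zmodPow 2 4 kA14 kB14 h'
    · exfalso
      have hd : d = 21 := by omega
      subst hd
      have h' := hloc.2 3
      rw [show (1008 : ℤ) / 21 = 48 by norm_num] at h'
      exact not_isSoluble_padic_of_zmodPow 2 2 kA21 kB21 h'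
    · exfalso
      have hd : d = 42 := by omega
      subst hd
      have h' := hloc.2 2
      rw [show (1008 : ℤ) / 42 = 24 by norm_num] at h'
      exact not_isSoluble_padic_of_zmodPow 2 4 kA42 kB42 h'
  · exfalso
    have hd0 : d < 0 := by rcases habs with h | h | h | h | h | h | h | h <;> omega
    refine not_isSoluble_real_twoIsogenyQuartic_of_neg_of_sq_lt hd0 ?_ hloc.1
    rw [Int.mul_ediv_cancel' hdvd]; norm_num

/-- **`S(126, −63) ⊆ {1, −3, −7, 21}`** (the descent on the divisors of `a² − 4b = −63`, i.e. `S^{(φ)}(E₃/ℚ)`): the classes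
`−1, 3, 7, −21` die `2`-adically (mod `16` in both charts); `1, −3, −7, 21` survive (`−7·(−63) ∈ ℚ^{×2}`: `T' ↦ −63 ≡ −7`; `−3` is
the class of the point `(−3, 36) ∈ E₃'(ℚ)`). [cite: SilvermanAEC2009, Prop. X.4.9 and Example X.4.10] -/
theorem mem_twoIsogenySelmerGroup_neg63 {d : ℤ} (h : d ∈ twoIsogenySelmerGroup 126 (-63)) :
    d ∈ ({1, -3, -7, 21} : Finset ℤ) := by
  haveI : Fact (Nat.Prime 2) := ⟨Nat.prime_two⟩
  obtain ⟨hsq, hdvd, hloc⟩ := (mem_twoIsogenySelmerGroup_iff (by norm_num : (-63 : ℤ) ≠ 0)).mp h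
  have habs := natAbs_mem_of_squarefree_of_dvd_neg63 hsq hdvd
  simp only [Finset.mem_insert, Finset.mem_singleton] at habs ⊢
  obtain ⟨⟨kA1, kB1⟩, ⟨kA3, kB3⟩, ⟨kA7, kB7⟩, ⟨kA21, kB21⟩⟩ := zmod_keys_neg63
  rcases Int.natAbs_eq d with hpos | hneg
  · rcases habs with h1 | h3 | h7 | h21
    · exact Or.inl (by omega)
    · exfalso
      have hd : d = 3 := by omega
      subst hd
      have h' := hloc.2 2
      rw [show (-63 : ℤ) / 3 = -21 by norm_num] at h'
      exact not_isSoluble_padic_of_zmodPow 4 4 kA3 kB3 h'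
    · exfalso
      have hd : d = 7 := by omega
      subst hd
      have h' := hloc.2 2
      rw [show (-63 : ℤ) / 7 = -9 by norm_num] at h'
      exact not_isSoluble_padic_of_zmodPow 4 4 kA7 kB7 h'
    · exact Or.inr (Or.inr (Or.inr (by omega)))
  · rcases habs with h1 | h3 | h7 | h21
    · exfalso
      have hd : d = -1 := by omega
      subst hd
      have h' := hloc.2 2
      rw [show (-63 : ℤ) / -1 = 63 by norm_num] at h'
      exact not_isSoluble_padic_of_zmodPow 4 4 kA1 kB1 h'
    · exact Or.inr (Or.inl (by omega))
    · exact Or.inr (Or.inr (Or.inl (by omega)))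
    · exfalso
      have hd : d = -21 := by omega
      subst hd
      have h' := hloc.2 2
      rw [show (-63 : ℤ) / -21 = 3 by norm_num] at h'
      exact not_isSoluble_padic_of_zmodPow 4 4 kA21 kB21 h'

/-- `#S(−63, 1008) ≤ 2`. [cite: SilvermanAEC2009, Prop. X.4.9] -/
theorem card_twoIsogenySelmerGroup_1008_le : (twoIsogenySelmerGroup (-63) 1008).card ≤ 2 :=
  le_trans (Finset.card_le_card fun d hd => by
    have := mem_twoIsogenySelmerGroup_1008 hd
    simp only [Finset.mem_insert, Finset.mem_singleton]
    exact this) (Finset.card_le_two (a := (1 : ℤ)) (b := 7))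

/-- `#S'(−63, 1008) = #S(126, −63) ≤ 4`. [cite: SilvermanAEC2009, Prop. X.4.9] -/
theorem card_twoIsogenySelmerGroup'_1008_le : (twoIsogenySelmerGroup' (-63) 1008).card ≤ 4 := by
  rw [twoIsogenySelmerGroup'_eq, show (-2 * -63 : ℤ) = 126 by norm_num, show ((-63 : ℤ) ^ 2 - 4 * 1008) = -63 by norm_num]
  exact le_trans (Finset.card_le_card fun d hd => mem_twoIsogenySelmerGroup_neg63 hd) Finset.card_le_four

end Selmer

/-! ## §3 `rank ≤ 1`, and `rank = 1 ⟹ Ш[2] = 0`, for every model of `49a1^{(−3)}` (UNCONDITIONAL) -/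

section Descent

/-- **`rank E₃(ℚ) ≤ 1`, and `rank = 1 ⟹ Ш(E₃/ℚ)[2] = 0`** (UNCONDITIONAL) for `E₃ = [0, −63, 0, 1008, 0]`: the descent count
`#S·#S' = 2^{rank+2}·#Ш(E')[φ̂]·#Ш(E)[φ] ≤ 2·4` (seat c301's `rank_le_one_and_sha_parts_of_card_mul_le`, Silverman X.4.2(a)) and
`forall_mem_sha_two_smul_eq_zero_of_halfModel`. [cite: SilvermanAEC2009, Thm. X.4.2(a), Prop. X.4.9] -/
theorem rank_le_one_and_sha_two_twoTorsionModel_negThree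
    [hE : (⟨0, ((-63 : ℤ) : ℚ), 0, ((1008 : ℤ) : ℚ), 0⟩ : WeierstrassCurve ℚ).IsElliptic] :
    (⟨0, ((-63 : ℤ) : ℚ), 0, ((1008 : ℤ) : ℚ), 0⟩ : WeierstrassCurve ℚ).mordellWeilRank ≤ 1 ∧
      ((⟨0, ((-63 : ℤ) : ℚ), 0, ((1008 : ℤ) : ℚ), 0⟩ : WeierstrassCurve ℚ).mordellWeilRank = 1 →
        ∀ c ∈ (⟨0, ((-63 : ℤ) : ℚ), 0, ((1008 : ℤ) : ℚ), 0⟩ : WeierstrassCurve ℚ).sha, 2 • c = 0 → c = 0) := by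
  have hab : (1008 : ℤ) * ((-63 : ℤ) ^ 2 - 4 * 1008) ≠ 0 := by norm_num
  haveI := isElliptic_halfModel hab
  obtain ⟨hr, hparts⟩ := rank_le_one_and_sha_parts_of_card_mul_le hab
    (le_trans (Nat.mul_le_mul card_twoIsogenySelmerGroup_1008_le card_twoIsogenySelmerGroup'_1008_le) (by norm_num))
  refine ⟨hr, fun h => ?_⟩
  obtain ⟨h₀, h₁⟩ := hparts h
  exact forall_mem_sha_two_smul_eq_zero_of_halfModel h₀ h₁

/-- **UNCONDITIONAL: `rank W(ℚ) ≤ 1`, and `rank W(ℚ) = 1 ⟹ Ш(W/ℚ)[2] = 0`, for EVERY model `W` of `49a1^{(−3)}`**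
(`C • W = cm7.quadraticTwist (−3)`), transported along the two-torsion change `smul_eq_twoTorsionModel_of_smul_eq_quadraticTwist`.
[cite: SilvermanAEC2009, Thm. X.4.2(a), Prop. X.4.9, Thm. III.6.2(a)] -/
theorem rank_le_one_and_sha_two_negThreeTwist (W : WeierstrassCurve ℚ) [W.IsElliptic] (C : VariableChange ℚ)
    (hC : C • W = cm7.quadraticTwist (((-3 : ℤ)) : ℚ)) :
    W.mordellWeilRank ≤ 1 ∧ (W.mordellWeilRank = 1 → ∀ c ∈ W.sha, 2 • c = 0 → c = 0) := by
  haveI := isElliptic_mk_of_ne_zero (F := ℚ) (by norm_num : (1008 : ℤ) * ((-63 : ℤ) ^ 2 - 4 * 1008) ≠ 0)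
  have hE := (smul_eq_twoTorsionModel_of_smul_eq_quadraticTwist (-3) W C hC).trans
    (show (⟨0, ((21 * (-3 : ℤ) : ℤ) : ℚ), 0, ((112 * (-3 : ℤ) ^ 2 : ℤ) : ℚ), 0⟩ : WeierstrassCurve ℚ) =
        ⟨0, ((-63 : ℤ) : ℚ), 0, ((1008 : ℤ) : ℚ), 0⟩ by ext <;> push_cast <;> ring)
  exact rank_le_one_and_sha_two_of_smul_eq W _ _ hE rank_le_one_and_sha_two_twoTorsionModel_negThree

end Descent

/-! ## §4 The partner package at `ℓ = 3` BY NAME: `r_an = 1`, `rank = 1`, `Ш` finite of odd order -/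

section Package

/-- `N(W') = 441` for every model `W'` of `49a1^{(−3)}` (`49·3²`; the twist by the odd fundamental discriminant `−3` prime to `7`).
[cite: MurtyMurty1997, Ch. 6 §1] -/
theorem conductorNorm_negThreeTwist (hnf : exists_isNewformOf) (h12 : thm12_fullBSD_twist) (W' : WeierstrassCurve ℚ)
    [W'.IsElliptic] {C : VariableChange ℚ} (hC' : C • W' = cm7.quadraticTwist (((-3 : ℤ)) : ℚ)) : W'.conductorNorm ℤ = 441 := by
  have h := (rootNumber_and_conductorNorm_quadraticTwist_cm7_of_emod_four_eq_one hnf h12 (d := -3) (by decide)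
    Int.prime_three.neg.squarefree (by decide)).2
  rw [← hC', conductorNorm_smul_rat] at h
  rw [h]; norm_num

/-- **THE `ℓ₀ = 3` PARTNER — the case Coates–Li–Tian–Zhai 2015 Thm. 1.4 (as typed, `3 < l₀`) excludes, in the exact output shape
of seat c3's `rankOne_negPrimeTwist_of_thm14'`.** For every globally minimal model `W'` of `49a1^{(−3)}`:
`ord_{s=1} L(W', s) = 1`, `rank W'(ℚ) = 1`, `Ш(W')` is finite and of ODD order. Proof: `rank ≤ 1` and `Ш[2] = 0` in rank one (§3,
unconditional); `N(W') = 49·9 = 441` (tree `rootNumber_and_conductorNorm_quadraticTwist_cm7_of_emod_four_eq_one`, `hnf h12`) is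
`< 130000`, so `r_an = rank` (Cremona, `hCr`), and `r_an` is odd on a negative twist prime to `7` (seat c301's
`analyticRank_eq_one_iff_le_one_of_smul_eq_quadraticTwist_cm7_of_neg`) — hence `r_an = rank = 1`; `N < 5000` and `rank ≤ 1` give the
full BSD triple (bsd.S31, `hS31`), in particular `Ш` finite, and a finite group without `2`-torsion has odd order. Conditional on the
named facts `hnf h12 hCr hS31` only. [cite: Cremona2006, rank tables (curve 441)] [cite: CreutzMiller2012, Thm 1.1 and the remark following it]
[cite: CoatesLiTianZhai2015, Thm. 1.4 (p. 360), the excluded case l₀ = 3] [cite: SilvermanAEC2009, Thm. X.4.2(a)] [cite: MurtyMurty1997, Ch. 6 §1] -/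
theorem rankOne_negPrimeTwist_three (hnf : exists_isNewformOf) (h12 : thm12_fullBSD_twist)
    (hCr : analyticRank_eq_mordellWeilRank_of_conductor_lt) (hS31 : bsdTriple_of_rank_le_one_of_conductor_lt)
    (W' : WeierstrassCurve ℚ) [W'.IsElliptic] [W'.IsGloballyMinimal]
    (hC : ∃ C : VariableChange ℚ, C • W' = cm7.quadraticTwist (-((3 : ℕ) : ℚ))) :
    W'.analyticRank = 1 ∧ W'.mordellWeilRank = 1 ∧ W'.ShaFinite ∧ Odd W'.shaOrder := by
  obtain ⟨C, hC⟩ := hC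
  have hC' : C • W' = cm7.quadraticTwist (((-3 : ℤ)) : ℚ) := by rw [hC]; norm_num
  obtain ⟨hrk, hsha⟩ := rank_le_one_and_sha_two_negThreeTwist W' C hC'
  have hN := conductorNorm_negThreeTwist hnf h12 W' hC'
  -- `r_an = rank ≤ 1` (Cremona) and `r_an` odd (negative twist)
  have heq : W'.analyticRank = W'.mordellWeilRank := hCr W' (by rw [hN]; norm_num)
  have har : W'.analyticRank = 1 :=
    (analyticRank_eq_one_iff_le_one_of_smul_eq_quadraticTwist_cm7_of_neg hnf h12 Int.prime_three.neg.squarefree (by decide)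
      (by decide) W' C hC').mpr
      (by rw [heq]; exact hrk)
  have hr : W'.mordellWeilRank = 1 := by rw [← heq, har]
  -- bsd.S31 at `N = 441 < 5000`
  obtain ⟨-, hfin, -⟩ := hS31 W' hrk (by rw [hN]; norm_num)
  refine ⟨har, hr, hfin, ?_⟩
  haveI : Finite W'.sha := hfin
  exact odd_natCard_of_forall_two_nsmul fun c hc ↦
    Subtype.ext (hsha hr c c.2 (by exact_mod_cast congrArg Subtype.val hc))

/-- **Full BSD for the minimal models of `49a1^{(−3)}` BY NAME** (bsd.S31 at `N = 441`, `rank ≤ 1` from §3) — recorded for the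
formula axis. [cite: CreutzMiller2012, Thm 1.1 and the remark following it] [cite: Miller2011LMS, Thm 1.2] -/
theorem bsdTriple_negPrimeTwist_three (hnf : exists_isNewformOf) (h12 : thm12_fullBSD_twist)
    (hS31 : bsdTriple_of_rank_le_one_of_conductor_lt)
    (W' : WeierstrassCurve ℚ) [W'.IsElliptic] [W'.IsGloballyMinimal]
    (hC : ∃ C : VariableChange ℚ, C • W' = cm7.quadraticTwist (-((3 : ℕ) : ℚ))) : W'.BSDTriple := by
  obtain ⟨C, hC⟩ := hC
  have hC' : C • W' = cm7.quadraticTwist (((-3 : ℤ)) : ℚ) := by rw [hC]; norm_num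
  exact hS31 W' (rank_le_one_and_sha_two_negThreeTwist W' C hC').1
    (by rw [conductorNorm_negThreeTwist hnf h12 W' hC']; norm_num)

/-- **THE PARTNER PACKAGE ON THE WHOLE FAMILY `ℓ ≡ 3 (mod 4)`, `(ℓ/7) = −1`** (no proviso `ℓ > 3`): for every such prime `ℓ` and every
globally minimal `W' ≅ 49a1^{(−ℓ)}`, `r_an = 1 ∧ rank = 1 ∧ Ш finite ∧ #Ш odd` — CLTZ Thm. 1.4 by name for `ℓ > 3` (seat c3's
`rankOne_negPrimeTwist_of_thm14'`) and §4 at `ℓ = 3`. Binders `h14 hnf h12 hCr hS31`. [cite: CoatesLiTianZhai2015, Thm. 1.4 (p. 360), case k = r = 0]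
[cite: Cremona2006, rank tables (curve 441)] [cite: CreutzMiller2012, Thm 1.1] -/
theorem rankOne_negPrimeTwist_threeModFour_of_print (h14 : thm14_rankOne_twist) (hnf : exists_isNewformOf)
    (h12 : thm12_fullBSD_twist) (hCr : analyticRank_eq_mordellWeilRank_of_conductor_lt)
    (hS31 : bsdTriple_of_rank_le_one_of_conductor_lt) {l : ℕ} (hl : l.Prime) (hl4 : l % 4 = 3)
    (hl7 : jacobiSym l 7 = -1) (W' : WeierstrassCurve ℚ) [W'.IsElliptic] [W'.IsGloballyMinimal]
    (hC : ∃ C : VariableChange ℚ, C • W' = cm7.quadraticTwist (-(l : ℚ))) :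
    W'.analyticRank = 1 ∧ W'.mordellWeilRank = 1 ∧ W'.ShaFinite ∧ Odd W'.shaOrder := by
  by_cases h3 : l = 3
  · subst h3
    exact rankOne_negPrimeTwist_three hnf h12 hCr hS31 W' hC
  · exact rankOne_negPrimeTwist_of_thm14' h14 hl (by have := hl.two_le; omega) hl4 hl7 W' hC

end Package

/-! ## §5 Interface to (RO″): `rank V₁(ℚ) = 1` in the currency of `…TwinHalfTraceSevenModEightRankOne`, from a partner package -/

section Interface

/-- **Partner-hypothesis form of `mordellWeilRank_twist_negPrime_one`.** If every globally minimal model of `49a1^{(−ℓ)}` has rank `1`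
(`hP` — CLTZ Thm. 1.4 for `ℓ > 3`, §4 for `ℓ = 3`, or any later source), then `rank V₁(ℚ) = 1` for `V₁ = (cm7^{(−ℓ)})^{(1)}` — the ONE
term the `K/ℚ` step `exists_two_zsmul_sub_incl_negEightPrime` of (RO″) takes from `h14`; a re-thread of (RO″)/(HR″) on a partner
package substitutes this lemma for that call. [cite: SilvermanAEC2009, X.2 Prop. 2.4 and Thm. VIII.6.7] -/
theorem mordellWeilRank_twist_negPrime_one_of_partner {l : ℕ} (hl : l ≠ 0)
    (hP : ∀ (W' : WeierstrassCurve ℚ) [W'.IsElliptic] [W'.IsGloballyMinimal],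
      (∃ C : VariableChange ℚ, C • W' = cm7.quadraticTwist (-(l : ℚ))) → W'.mordellWeilRank = 1) :
    (haveI := isElliptic_twist_negPrime_one hl;
      ((cm7.quadraticTwist (-(l : ℚ))).quadraticTwist 1).mordellWeilRank) = 1 := by
  have hd : (-(l : ℚ)) ≠ 0 := neg_ne_zero.mpr (by exact_mod_cast hl)
  haveI := cm7.isElliptic_quadraticTwist hd
  haveI := isElliptic_twist_negPrime_one hl
  obtain ⟨W', hE', hmin', C, hC⟩ := exists_isGloballyMinimal_smul_eq_quadraticTwist cm7 hd
  have h2 : (cm7.quadraticTwist (-(l : ℚ))).mordellWeilRank = 1 := by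
    have h := mordellWeilRank_variableChange_holds W' C
    unfold mordellWeilRank_variableChange at h
    rw [← hC, h, hP W' ⟨C, hC⟩]
  rw [mordellWeilRank_congr (quadraticTwist_negPrime_quadraticTwist_one l), h2]

/-- **`rank V₁(ℚ) = 1` at `ℓ = 3`** (`V₁ = (cm7^{(−3)})^{(1)}`), from §4 — binders `hnf h12 hCr hS31`.
[cite: Cremona2006, rank tables (curve 441)] [cite: SilvermanAEC2009, Thm. X.4.2(a)] -/
theorem mordellWeilRank_twist_negThree_one (hnf : exists_isNewformOf) (h12 : thm12_fullBSD_twist)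
    (hCr : analyticRank_eq_mordellWeilRank_of_conductor_lt) (hS31 : bsdTriple_of_rank_le_one_of_conductor_lt) :
    (haveI := isElliptic_twist_negPrime_one (l := 3) three_ne_zero;
      ((cm7.quadraticTwist (-((3 : ℕ) : ℚ))).quadraticTwist 1).mordellWeilRank) = 1 :=
  mordellWeilRank_twist_negPrime_one_of_partner three_ne_zero fun W' _ _ hC ↦
    (rankOne_negPrimeTwist_three hnf h12 hCr hS31 W' hC).2.1

/-- **`rank V₁(ℚ) = 1` for EVERY prime `ℓ ≡ 3 (mod 4)` with `(ℓ/7) = −1`** (no proviso `ℓ > 3`): K2's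
`mordellWeilRank_twist_negPrime_one` for `ℓ > 3`, the previous lemma at `ℓ = 3`. [cite: CoatesLiTianZhai2015, Thm. 1.4 (p. 360)]
[cite: Cremona2006, rank tables (curve 441)] -/
theorem mordellWeilRank_twist_negPrime_one_of_print (h14 : thm14_rankOne_twist) (hnf : exists_isNewformOf)
    (h12 : thm12_fullBSD_twist) (hCr : analyticRank_eq_mordellWeilRank_of_conductor_lt)
    (hS31 : bsdTriple_of_rank_le_one_of_conductor_lt) {l : ℕ} (hl : l.Prime) (hl4 : l % 4 = 3) (hl7 : jacobiSym l 7 = -1) :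
    (haveI := isElliptic_twist_negPrime_one hl.ne_zero;
      ((cm7.quadraticTwist (-(l : ℚ))).quadraticTwist 1).mordellWeilRank) = 1 :=
  mordellWeilRank_twist_negPrime_one_of_partner hl.ne_zero fun W' _ _ hC ↦
    (rankOne_negPrimeTwist_threeModFour_of_print h14 hnf h12 hCr hS31 hl hl4 hl7 W' hC).2.1

end Interface

end Summit.BirchSwinnertonDyer.BirchSwinnertonDyer.Theorems.GoldfeldGoodTwists

end
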